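import Summits.AtomisticToContinuum.HydrodynamicLimit.Theorems.AntiMazurCoboundariesCellForecastPressureDecayContactLayerBounds
import Summits.AtomisticToContinuum.HydrodynamicLimit.Theorems.AntiMazurCoboundariesCellForecastPressureDecayContactStatisticsTreeBound
import Summits.AtomisticToContinuum.HydrodynamicLimit.Theorems.AntiMazurCoboundariesCellForecastPressureDecayContactStatisticsTail
import HarnessLib

/-!
# S2c(H) · boundary-layer bounds on the brackets of the two-marked expansion in the cube
# (piece of stub `stub_contactStatistics`, crux line `enskog-compensator-martingale`,
# crux `CellForecastPressureDecay`, stmt-AtomisticToContinuum-13915)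

In the proof of the weak isotropy of the pair law of the cell (companion files), the difference
`E ψ(xᵢ − xⱼ) − E ψ(g(xᵢ − xⱼ))` is expanded in clusters (`…Expansion`); by the bulk invariance (`…Bulk`) each
bracket reduces to its BOUNDARY-LAYER part `∫ 𝟙_{layer}(xᵢ) Δ(xᵢ,xⱼ) u_B (u_{B'})`, `Δ = ψ(· − ·) − ψ(g(· − ·))`. This
file bounds these boundary-layer brackets for `n` independent uniform points of the cube `[0,L]³` by the tree bounds
with a two-body weight (`…TreeBound`, `…Tail`):

* § 1 one-point masses under the uniform law on the cube: the boundary layer of width `D` has mass `≤ 6D/L`, and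
  the two-body weight `|ψ(z − ·)| + |ψ(g(z − ·))|` has mass `≤ 2 L⁻³ ∫|ψ|` whatever `z` (translation and isometry
  invariance of Lebesgue measure);
* § 2 `abs_integral_mul_uR_le_lintegral` — `|∫ F u_B| ≤ ∫⁻ ‖F‖ₑ |u_B|`;
* § 3 the bracket bounds: `|∫ 𝟙_{layer D}(xᵢ) Δ u_B| ≤ (6D/L)(2L⁻³∫|ψ|) t(#B) p^{#B−2}` for `i ≠ j ∈ B`
  (`abs_layerBracket_le`) and `|∫ 𝟙_{layer D}(xᵢ) Δ u_B u_{B'}| ≤ (6D/L)(2L⁻³∫|ψ|) t(#B)p^{#B−1} t(#B')p^{#B'−1}` for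
  `i ∈ B`, `j ∈ B'` disjoint (`abs_layerBracket₂_le`), `p = (4π/3)σ³/L³` the mass of one excluded ball;
* § 4 the registered sub-goal `stub_contactStatistics_brackets`.

References: E. Pulvirenti, D. Tsagkarogiannis, Comm. Math. Phys. 316 (2012) 289–306, §4.
-/

noncomputable section

open MeasureTheory ProbabilityTheory Set Filter
open scoped ENNReal BigOperators
open Literature.Analysis.FluidPDE Literature.MathematicalPhysics.KineticTheory
open Literature.MathematicalPhysics.StatisticalMechanics
open Literature.Probability.LatticeModels (treeNumber)
open Summit.AtomisticToContinuum.HydrodynamicLimit.Theorems.CellForecastPressureDecay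
  (cellCube measurableSet_cellCube volume_cellCube)

namespace Summit.AtomisticToContinuum.HydrodynamicLimit.Theorems.EnskogCompensator

/-! ## § 1 One-point masses under the uniform law on the cube -/

/-- `∫⁻ f dν ≤ (vol[0,L]³)⁻¹ ∫⁻ f dvol` for the uniform law `ν` on the cube. [folklore] -/
theorem lintegral_cond_cellCube_le (L : ℝ) (f : V3 → ℝ≥0∞) :
    ∫⁻ y, f y ∂(volume[|cellCube L]) ≤ (volume (cellCube L))⁻¹ * ∫⁻ y, f y ∂volume := by
  rw [ProbabilityTheory.cond, lintegral_smul_measure, smul_eq_mul]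
  exact mul_le_mul' le_rfl (lintegral_mono' Measure.restrict_le_self le_rfl)

/-- **The boundary layer is thin** under the uniform law: `ν{∃ c, z_c < D ∨ L − D < z_c} ≤ 6D/L`. [folklore] -/
theorem cond_cellCube_layer_le {L D : ℝ} (hL : 0 < L) (hD : 0 ≤ D) :
    volume[|cellCube L] {z : V3 | ∃ c, z c < D ∨ L - D < z c} ≤ ENNReal.ofReal (6 * D / L) := by
  rw [cond_apply (measurableSet_cellCube L), inv_volume_cellCube hL]
  calc ENNReal.ofReal ((L ^ 3)⁻¹) * volume (cellCube L ∩ {z : V3 | ∃ c, z c < D ∨ L - D < z c})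
      ≤ ENNReal.ofReal ((L ^ 3)⁻¹) * ENNReal.ofReal (6 * (D * L ^ 2)) :=
        mul_le_mul' le_rfl (volume_cellCube_inter_layer_le hL hD)
    _ = ENNReal.ofReal (6 * D / L) := by
        rw [← ENNReal.ofReal_mul (by positivity)]
        congr 1
        field_simp

/-- **The two-body weight has small mass whatever the first point**: for a linear isometry `g`,
`∫⁻ (‖ψ(z − y)‖ₑ + ‖ψ(g(z − y))‖ₑ) dν(y) ≤ (vol[0,L]³)⁻¹ · 2 ∫⁻ ‖ψ‖ₑ`. [folklore] -/
theorem lintegral_twoBody_le (L : ℝ) {ψ : V3 → ℝ} (hψ : Measurable ψ) (g : V3 ≃ₗᵢ[ℝ] V3) (z : V3) :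
    ∫⁻ y, (‖ψ (z - y)‖ₑ + ‖ψ (g (z - y))‖ₑ) ∂(volume[|cellCube L]) ≤
      (volume (cellCube L))⁻¹ * (2 * ∫⁻ q, ‖ψ q‖ₑ ∂volume) := by
  refine (lintegral_cond_cellCube_le L _).trans (mul_le_mul' le_rfl (le_of_eq ?_))
  have h1 : ∫⁻ y, ‖ψ (z - y)‖ₑ ∂volume = ∫⁻ q, ‖ψ q‖ₑ ∂volume :=
    lintegral_sub_left_eq_self (fun q => ‖ψ q‖ₑ) z
  have h2 : ∫⁻ y, ‖ψ (g (z - y))‖ₑ ∂volume = ∫⁻ q, ‖ψ q‖ₑ ∂volume := by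
    rw [lintegral_sub_left_eq_self (fun q => ‖ψ (g q)‖ₑ) z]
    exact g.measurePreserving.lintegral_comp hψ.enorm
  have hm : Measurable fun y : V3 => ‖ψ (z - y)‖ₑ := (hψ.comp (measurable_const.sub measurable_id)).enorm
  rw [lintegral_add_left hm, h1, h2, two_mul]

/-! ## § 2 From real brackets to weighted tree bounds -/

/-- `|∫ F W| ≤ (∫⁻ ‖F‖ₑ ‖W‖ₑ).toReal` for measurable `F, W`. [folklore] -/
theorem abs_integral_mul_le_lintegral {α : Type*} [MeasurableSpace α] (P : Measure α) {F W : α → ℝ}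
    (hF : Measurable F) (hW : Measurable W) :
    |∫ x, F x * W x ∂P| ≤ (∫⁻ x, ‖F x‖ₑ * ‖W x‖ₑ ∂P).toReal := by
  calc |∫ x, F x * W x ∂P| ≤ ∫ x, |F x * W x| ∂P := abs_integral_le_integral_abs
    _ = (∫⁻ x, ENNReal.ofReal |F x * W x| ∂P).toReal :=
        integral_eq_lintegral_of_nonneg_ae (Eventually.of_forall fun x => abs_nonneg _)
          (hF.mul hW).abs.aestronglyMeasurable
    _ = (∫⁻ x, ‖F x‖ₑ * ‖W x‖ₑ ∂P).toReal := by
        congr 1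
        refine lintegral_congr fun x => ?_
        rw [abs_mul, ENNReal.ofReal_mul (abs_nonneg _), Real.enorm_eq_ofReal_abs, Real.enorm_eq_ofReal_abs]

/-- The boundary layer of the cube is a measurable subset of `ℝ³`. [folklore] -/
theorem measurableSet_layer_V3 (L D : ℝ) : MeasurableSet {z : V3 | ∃ c, z c < D ∨ L - D < z c} :=
  (measurableSet_layer L D).preimage (PiLp.volume_preserving_ofLp (Fin 3)).measurable

/-- The boundary-layer two-body weight is dominated by the product of the `ℝ≥0∞` weights of the tree bounds.
[folklore] -/
theorem enorm_layerWeight_le (L D : ℝ) (ψ : V3 → ℝ) (g : V3 ≃ₗᵢ[ℝ] V3) (a b : V3) :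
    ‖{z : V3 | ∃ c, z c < D ∨ L - D < z c}.indicator (fun _ => (1 : ℝ)) a * (ψ (a - b) - ψ (g (a - b)))‖ₑ ≤
      {z : V3 | ∃ c, z c < D ∨ L - D < z c}.indicator (fun _ => (1 : ℝ≥0∞)) a *
        (‖ψ (a - b)‖ₑ + ‖ψ (g (a - b))‖ₑ) := by
  by_cases ha : a ∈ {z : V3 | ∃ c, z c < D ∨ L - D < z c}
  · rw [Set.indicator_of_mem ha, Set.indicator_of_mem ha, one_mul, one_mul]
    exact enorm_sub_le
  · rw [Set.indicator_of_notMem ha, Set.indicator_of_notMem ha, zero_mul, zero_mul, enorm_zero]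

/-- `2 ∫⁻ ‖ψ‖ₑ = ofReal (2 ∫ |ψ|)` for an integrable real `ψ`. [folklore] -/
theorem two_mul_lintegral_enorm_eq {ψ : V3 → ℝ} (hψi : Integrable ψ volume) :
    (2 : ℝ≥0∞) * ∫⁻ q, ‖ψ q‖ₑ ∂volume = ENNReal.ofReal (2 * ∫ q, |ψ q|) := by
  rw [← ofReal_integral_norm_eq_lintegral_enorm hψi, ENNReal.ofReal_mul zero_le_two, ENNReal.ofReal_ofNat]
  simp only [Real.norm_eq_abs]

/-! ## § 3 The boundary-layer bracket bounds -/

/-- **Boundary-layer bracket, both marked points in one cluster.** For `n` independent uniform points of the cube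
`[0,L]³`, `i ≠ j` in the block `B`, a measurable integrable `ψ`, a linear isometry `g` and `D ≥ 0`,
`|∫ 𝟙_{layer D}(xᵢ) (ψ(xᵢ − xⱼ) − ψ(g(xᵢ − xⱼ))) u_B dν^{⊗n}| ≤ (6D/L) · (L⁻³ · 2∫|ψ|) · t(#B) p^{#B−2}`,
`p = (4π/3)σ³/L³`. [cite: PulvirentiTsagkarogiannis2012, §4] -/
theorem abs_layerBracket_le {σ L : ℝ} (hσ : 0 < σ) (hL : 0 < L) {n : ℕ} {ψ : V3 → ℝ} (hψm : Measurable ψ)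
    (hψi : Integrable ψ volume) (g : V3 ≃ₗᵢ[ℝ] V3) {D : ℝ} (hD : 0 ≤ D) {B : Finset (Fin n)} {i j : Fin n}
    (hi : i ∈ B) (hj : j ∈ B) (hij : i ≠ j) :
    |∫ x, {z : V3 | ∃ c, z c < D ∨ L - D < z c}.indicator (fun _ => (1 : ℝ)) (x i) *
        (ψ (x i - x j) - ψ (g (x i - x j))) * uR (fun y y' : V3 => ‖y - y'‖ < σ) x B
        ∂(Measure.pi fun _ : Fin n => volume[|cellCube L])| ≤
      (6 * D / L) * ((L ^ 3)⁻¹ * (2 * ∫ q, |ψ q|)) *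
        (treeNumber B.card * ((L ^ 3)⁻¹ * (σ ^ 3 * (Real.pi * 4 / 3))) ^ (B.card - 2)) := by
  haveI := isProbabilityMeasure_cond_cellCube hL
  have hO := measurableSet_overlap_lt σ
  have hOs : ∀ a b : V3, (fun y y' : V3 => ‖y - y'‖ < σ) a b → (fun y y' : V3 => ‖y - y'‖ < σ) b a :=
    fun a b h => by simpa [norm_sub_rev] using h
  have hp0 : 0 ≤ (L ^ 3)⁻¹ * (σ ^ 3 * (Real.pi * 4 / 3)) := by positivity
  have hp : ∀ z, volume[|cellCube L] {y | (fun y y' : V3 => ‖y - y'‖ < σ) z y} ≤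
      ENNReal.ofReal ((L ^ 3)⁻¹ * (σ ^ 3 * (Real.pi * 4 / 3))) := fun z => cond_cellCube_ball_le hL hσ.le z
  have hLay := measurableSet_layer_V3 L D
  have hφ : Measurable fun a : V3 => {z : V3 | ∃ c, z c < D ∨ L - D < z c}.indicator (fun _ => (1 : ℝ≥0∞)) a :=
    measurable_const.indicator hLay
  have hΦ : Measurable fun q : V3 × V3 => ‖ψ (q.1 - q.2)‖ₑ + ‖ψ (g (q.1 - q.2))‖ₑ :=
    (hψm.comp (measurable_fst.sub measurable_snd)).enorm.add
      (hψm.comp (g.continuous.measurable.comp (measurable_fst.sub measurable_snd))).enorm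
  have hF : Measurable fun x : Fin n → V3 => {z : V3 | ∃ c, z c < D ∨ L - D < z c}.indicator (fun _ => (1 : ℝ)) (x i) *
      (ψ (x i - x j) - ψ (g (x i - x j))) :=
    ((measurable_const.indicator hLay).comp (measurable_pi_apply i)).mul
      ((hψm.comp ((measurable_pi_apply i).sub (measurable_pi_apply j))).sub
        (hψm.comp (g.continuous.measurable.comp ((measurable_pi_apply i).sub (measurable_pi_apply j)))))
  -- Step 1: real bracket ≤ weighted tree-bound integrand
  refine (abs_integral_mul_le_lintegral _ hF (measurable_uR hO B)).trans ?_
  have hM : 0 ≤ (6 * D / L) * ((L ^ 3)⁻¹ * (2 * ∫ q, |ψ q|)) *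
      (treeNumber B.card * ((L ^ 3)⁻¹ * (σ ^ 3 * (Real.pi * 4 / 3))) ^ (B.card - 2)) := by
    have : 0 ≤ ∫ q, |ψ q| := integral_nonneg fun q => abs_nonneg _
    positivity
  refine ENNReal.toReal_le_of_le_ofReal hM ?_
  -- Step 2: the two-weight tree bound
  have hTW := lintegral_mul_mul₂_aU_le (volume[|cellCube L]) hO hOs hp0 hp B hi hj hij hφ
    (Φ := fun a b => ‖ψ (a - b)‖ₑ + ‖ψ (g (a - b))‖ₑ) hΦ
  have hmass : ∫⁻ z, {z : V3 | ∃ c, z c < D ∨ L - D < z c}.indicator (fun _ => (1 : ℝ≥0∞)) z *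
      ∫⁻ y, (‖ψ (z - y)‖ₑ + ‖ψ (g (z - y))‖ₑ) ∂(volume[|cellCube L]) ∂(volume[|cellCube L]) ≤
        ENNReal.ofReal (6 * D / L) * (ENNReal.ofReal ((L ^ 3)⁻¹) * (2 * ∫⁻ q, ‖ψ q‖ₑ ∂volume)) := by
    calc ∫⁻ z, {z : V3 | ∃ c, z c < D ∨ L - D < z c}.indicator (fun _ => (1 : ℝ≥0∞)) z *
          ∫⁻ y, (‖ψ (z - y)‖ₑ + ‖ψ (g (z - y))‖ₑ) ∂(volume[|cellCube L]) ∂(volume[|cellCube L])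
        ≤ ∫⁻ z, {z : V3 | ∃ c, z c < D ∨ L - D < z c}.indicator (fun _ => (1 : ℝ≥0∞)) z *
            ((volume (cellCube L))⁻¹ * (2 * ∫⁻ q, ‖ψ q‖ₑ ∂volume)) ∂(volume[|cellCube L]) :=
          lintegral_mono fun z => mul_le_mul' le_rfl (lintegral_twoBody_le L hψm g z)
      _ = volume[|cellCube L] {z : V3 | ∃ c, z c < D ∨ L - D < z c} *
            ((volume (cellCube L))⁻¹ * (2 * ∫⁻ q, ‖ψ q‖ₑ ∂volume)) := by
          rw [lintegral_mul_const _ hφ, lintegral_indicator_const hLay, one_mul]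
      _ ≤ _ := by
          rw [inv_volume_cellCube hL]
          exact mul_le_mul' (cond_cellCube_layer_le hL hD) le_rfl
  calc ∫⁻ x, ‖{z : V3 | ∃ c, z c < D ∨ L - D < z c}.indicator (fun _ => (1 : ℝ)) (x i) *
        (ψ (x i - x j) - ψ (g (x i - x j)))‖ₑ * ‖uR (fun y y' : V3 => ‖y - y'‖ < σ) x B‖ₑ
        ∂(Measure.pi fun _ : Fin n => volume[|cellCube L])
      ≤ ∫⁻ x, {z : V3 | ∃ c, z c < D ∨ L - D < z c}.indicator (fun _ => (1 : ℝ≥0∞)) (x i) *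
          (‖ψ (x i - x j)‖ₑ + ‖ψ (g (x i - x j))‖ₑ) * aU (fun y y' : V3 => ‖y - y'‖ < σ) x B
          ∂(Measure.pi fun _ : Fin n => volume[|cellCube L]) :=
        lintegral_mono fun x => by
          rw [aU, ← Real.enorm_eq_ofReal_abs]
          exact mul_le_mul' (enorm_layerWeight_le L D ψ g (x i) (x j)) le_rfl
    _ ≤ _ := hTW
    _ ≤ ENNReal.ofReal (6 * D / L) * (ENNReal.ofReal ((L ^ 3)⁻¹) * (2 * ∫⁻ q, ‖ψ q‖ₑ ∂volume)) *
          ENNReal.ofReal (treeNumber B.card * ((L ^ 3)⁻¹ * (σ ^ 3 * (Real.pi * 4 / 3))) ^ (B.card - 2)) :=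
        mul_le_mul' hmass le_rfl
    _ = _ := by
        have hI0 : 0 ≤ ∫ q, |ψ q| := integral_nonneg fun q => abs_nonneg _
        rw [two_mul_lintegral_enorm_eq hψi, ← ENNReal.ofReal_mul (by positivity : (0 : ℝ) ≤ (L ^ 3)⁻¹),
          ← ENNReal.ofReal_mul (by positivity : (0 : ℝ) ≤ 6 * D / L),
          ← ENNReal.ofReal_mul (by positivity : (0 : ℝ) ≤ 6 * D / L * ((L ^ 3)⁻¹ * (2 * ∫ q, |ψ q|)))]

/-- **Boundary-layer bracket, the marked points in two disjoint clusters.** For `n` independent uniform points of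
the cube `[0,L]³`, `i ∈ B`, `j ∈ B'` disjoint blocks, a measurable integrable `ψ`, a linear isometry `g` and `D ≥ 0`,
`|∫ 𝟙_{layer D}(xᵢ) (ψ(xᵢ − xⱼ) − ψ(g(xᵢ − xⱼ))) u_B u_{B'} dν^{⊗n}| ≤ (6D/L)(L⁻³ 2∫|ψ|) t(#B)p^{#B−1} t(#B')p^{#B'−1}`.
[cite: PulvirentiTsagkarogiannis2012, §4] -/
theorem abs_layerBracket₂_le {σ L : ℝ} (hσ : 0 < σ) (hL : 0 < L) {n : ℕ} {ψ : V3 → ℝ} (hψm : Measurable ψ)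
    (hψi : Integrable ψ volume) (g : V3 ≃ₗᵢ[ℝ] V3) {D : ℝ} (hD : 0 ≤ D) {B B' : Finset (Fin n)} {i j : Fin n}
    (hi : i ∈ B) (hj : j ∈ B') (hBB' : Disjoint B B') :
    |∫ x, {z : V3 | ∃ c, z c < D ∨ L - D < z c}.indicator (fun _ => (1 : ℝ)) (x i) *
        (ψ (x i - x j) - ψ (g (x i - x j))) *
          (uR (fun y y' : V3 => ‖y - y'‖ < σ) x B * uR (fun y y' : V3 => ‖y - y'‖ < σ) x B')
        ∂(Measure.pi fun _ : Fin n => volume[|cellCube L])| ≤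
      (6 * D / L) * ((L ^ 3)⁻¹ * (2 * ∫ q, |ψ q|)) *
        ((treeNumber B.card * ((L ^ 3)⁻¹ * (σ ^ 3 * (Real.pi * 4 / 3))) ^ (B.card - 1)) *
          (treeNumber B'.card * ((L ^ 3)⁻¹ * (σ ^ 3 * (Real.pi * 4 / 3))) ^ (B'.card - 1))) := by
  haveI := isProbabilityMeasure_cond_cellCube hL
  have hO := measurableSet_overlap_lt σ
  have hOs : ∀ a b : V3, (fun y y' : V3 => ‖y - y'‖ < σ) a b → (fun y y' : V3 => ‖y - y'‖ < σ) b a :=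
    fun a b h => by simpa [norm_sub_rev] using h
  have hp0 : 0 ≤ (L ^ 3)⁻¹ * (σ ^ 3 * (Real.pi * 4 / 3)) := by positivity
  have hp : ∀ z, volume[|cellCube L] {y | (fun y y' : V3 => ‖y - y'‖ < σ) z y} ≤
      ENNReal.ofReal ((L ^ 3)⁻¹ * (σ ^ 3 * (Real.pi * 4 / 3))) := fun z => cond_cellCube_ball_le hL hσ.le z
  have hLay := measurableSet_layer_V3 L D
  have hφ : Measurable fun a : V3 => {z : V3 | ∃ c, z c < D ∨ L - D < z c}.indicator (fun _ => (1 : ℝ≥0∞)) a :=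
    measurable_const.indicator hLay
  have hΦ : Measurable fun q : V3 × V3 => ‖ψ (q.1 - q.2)‖ₑ + ‖ψ (g (q.1 - q.2))‖ₑ :=
    (hψm.comp (measurable_fst.sub measurable_snd)).enorm.add
      (hψm.comp (g.continuous.measurable.comp (measurable_fst.sub measurable_snd))).enorm
  have hF : Measurable fun x : Fin n → V3 => {z : V3 | ∃ c, z c < D ∨ L - D < z c}.indicator (fun _ => (1 : ℝ)) (x i) *
      (ψ (x i - x j) - ψ (g (x i - x j))) :=
    ((measurable_const.indicator hLay).comp (measurable_pi_apply i)).mul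
      ((hψm.comp ((measurable_pi_apply i).sub (measurable_pi_apply j))).sub
        (hψm.comp (g.continuous.measurable.comp ((measurable_pi_apply i).sub (measurable_pi_apply j)))))
  refine (abs_integral_mul_le_lintegral _ hF ((measurable_uR hO B).mul (measurable_uR hO B'))).trans ?_
  have hI0 : 0 ≤ ∫ q, |ψ q| := integral_nonneg fun q => abs_nonneg _
  have hM : 0 ≤ (6 * D / L) * ((L ^ 3)⁻¹ * (2 * ∫ q, |ψ q|)) *
      ((treeNumber B.card * ((L ^ 3)⁻¹ * (σ ^ 3 * (Real.pi * 4 / 3))) ^ (B.card - 1)) *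
        (treeNumber B'.card * ((L ^ 3)⁻¹ * (σ ^ 3 * (Real.pi * 4 / 3))) ^ (B'.card - 1))) := by positivity
  refine ENNReal.toReal_le_of_le_ofReal hM ?_
  have hTW := lintegral_mul_mul₂_aU_aU_le (volume[|cellCube L]) hO hOs hp0 hp hi hj hBB' hφ
    (Φ := fun a b => ‖ψ (a - b)‖ₑ + ‖ψ (g (a - b))‖ₑ) hΦ
  have hmass : ∫⁻ z, {z : V3 | ∃ c, z c < D ∨ L - D < z c}.indicator (fun _ => (1 : ℝ≥0∞)) z *
      ∫⁻ y, (‖ψ (z - y)‖ₑ + ‖ψ (g (z - y))‖ₑ) ∂(volume[|cellCube L]) ∂(volume[|cellCube L]) ≤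
        ENNReal.ofReal (6 * D / L) * (ENNReal.ofReal ((L ^ 3)⁻¹) * (2 * ∫⁻ q, ‖ψ q‖ₑ ∂volume)) := by
    calc ∫⁻ z, {z : V3 | ∃ c, z c < D ∨ L - D < z c}.indicator (fun _ => (1 : ℝ≥0∞)) z *
          ∫⁻ y, (‖ψ (z - y)‖ₑ + ‖ψ (g (z - y))‖ₑ) ∂(volume[|cellCube L]) ∂(volume[|cellCube L])
        ≤ ∫⁻ z, {z : V3 | ∃ c, z c < D ∨ L - D < z c}.indicator (fun _ => (1 : ℝ≥0∞)) z *
            ((volume (cellCube L))⁻¹ * (2 * ∫⁻ q, ‖ψ q‖ₑ ∂volume)) ∂(volume[|cellCube L]) :=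
          lintegral_mono fun z => mul_le_mul' le_rfl (lintegral_twoBody_le L hψm g z)
      _ = volume[|cellCube L] {z : V3 | ∃ c, z c < D ∨ L - D < z c} *
            ((volume (cellCube L))⁻¹ * (2 * ∫⁻ q, ‖ψ q‖ₑ ∂volume)) := by
          rw [lintegral_mul_const _ hφ, lintegral_indicator_const hLay, one_mul]
      _ ≤ _ := by
          rw [inv_volume_cellCube hL]
          exact mul_le_mul' (cond_cellCube_layer_le hL hD) le_rfl
  calc ∫⁻ x, ‖{z : V3 | ∃ c, z c < D ∨ L - D < z c}.indicator (fun _ => (1 : ℝ)) (x i) *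
        (ψ (x i - x j) - ψ (g (x i - x j)))‖ₑ *
          ‖uR (fun y y' : V3 => ‖y - y'‖ < σ) x B * uR (fun y y' : V3 => ‖y - y'‖ < σ) x B'‖ₑ
        ∂(Measure.pi fun _ : Fin n => volume[|cellCube L])
      ≤ ∫⁻ x, {z : V3 | ∃ c, z c < D ∨ L - D < z c}.indicator (fun _ => (1 : ℝ≥0∞)) (x i) *
          (‖ψ (x i - x j)‖ₑ + ‖ψ (g (x i - x j))‖ₑ) *
            (aU (fun y y' : V3 => ‖y - y'‖ < σ) x B * aU (fun y y' : V3 => ‖y - y'‖ < σ) x B')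
          ∂(Measure.pi fun _ : Fin n => volume[|cellCube L]) :=
        lintegral_mono fun x => by
          refine mul_le_mul' (enorm_layerWeight_le L D ψ g (x i) (x j)) (le_of_eq ?_)
          rw [enorm_mul, aU, aU, Real.enorm_eq_ofReal_abs, Real.enorm_eq_ofReal_abs]
    _ ≤ _ := hTW
    _ ≤ ENNReal.ofReal (6 * D / L) * (ENNReal.ofReal ((L ^ 3)⁻¹) * (2 * ∫⁻ q, ‖ψ q‖ₑ ∂volume)) *
          ENNReal.ofReal (treeNumber B.card * ((L ^ 3)⁻¹ * (σ ^ 3 * (Real.pi * 4 / 3))) ^ (B.card - 1)) *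
          ENNReal.ofReal (treeNumber B'.card * ((L ^ 3)⁻¹ * (σ ^ 3 * (Real.pi * 4 / 3))) ^ (B'.card - 1)) :=
        mul_le_mul' (mul_le_mul' hmass le_rfl) le_rfl
    _ = _ := by
        rw [two_mul_lintegral_enorm_eq hψi, ← ENNReal.ofReal_mul (by positivity : (0 : ℝ) ≤ (L ^ 3)⁻¹),
          ← ENNReal.ofReal_mul (by positivity : (0 : ℝ) ≤ 6 * D / L),
          ← ENNReal.ofReal_mul (by positivity : (0 : ℝ) ≤ 6 * D / L * ((L ^ 3)⁻¹ * (2 * ∫ q, |ψ q|))),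
          ← ENNReal.ofReal_mul (by positivity : (0 : ℝ) ≤ 6 * D / L * ((L ^ 3)⁻¹ * (2 * ∫ q, |ψ q|)) *
            (treeNumber B.card * ((L ^ 3)⁻¹ * (σ ^ 3 * (Real.pi * 4 / 3))) ^ (B.card - 1))), mul_assoc]

/-! ## § 4 The registered sub-goal -/

/-- **Registered sub-goal `stub_contactStatistics_brackets`** (piece of stub `stub_contactStatistics`, S2c, of the
line `enskog-compensator-martingale`): the boundary-layer bracket bounds of the two-marked expansion for `n` independent
uniform points of the cube `[0,L]³` — with `Δ = ψ(xᵢ − xⱼ) − ψ(g(xᵢ − xⱼ))`, `𝟙_{layer D}(xᵢ)` the indicator that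
`xᵢ` is within `D` of the boundary, `p = (4π/3)σ³/L³`: (i) `|∫ 𝟙 Δ u_B| ≤ (6D/L)(L⁻³ 2∫|ψ|) t(#B) p^{#B−2}` for
`i ≠ j ∈ B`; (ii) `|∫ 𝟙 Δ u_B u_{B'}| ≤ (6D/L)(L⁻³ 2∫|ψ|) t(#B)p^{#B−1} t(#B')p^{#B'−1}` for `i ∈ B`, `j ∈ B'`
disjoint. [cite: PulvirentiTsagkarogiannis2012, §4] -/
theorem stub_contactStatistics_brackets : ∀ (σ L : ℝ), 0 < σ → 0 < L → ∀ (n : ℕ) (ψ : V3 → ℝ), Measurable ψ →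
    Integrable ψ volume → ∀ (g : V3 ≃ₗᵢ[ℝ] V3) (D : ℝ), 0 ≤ D →
    (∀ (B : Finset (Fin n)) (i j : Fin n), i ∈ B → j ∈ B → i ≠ j →
      |∫ x, {z : V3 | ∃ c, z c < D ∨ L - D < z c}.indicator (fun _ => (1 : ℝ)) (x i) *
          (ψ (x i - x j) - ψ (g (x i - x j))) * uR (fun y y' : V3 => ‖y - y'‖ < σ) x B
          ∂(Measure.pi fun _ : Fin n => ProbabilityTheory.cond volume {y : V3 | ∀ k, y k ∈ Set.Icc (0 : ℝ) L})| ≤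
        (6 * D / L) * ((L ^ 3)⁻¹ * (2 * ∫ q, |ψ q|)) *
          (treeNumber B.card * ((L ^ 3)⁻¹ * (σ ^ 3 * (Real.pi * 4 / 3))) ^ (B.card - 2))) ∧
    (∀ (B B' : Finset (Fin n)) (i j : Fin n), i ∈ B → j ∈ B' → Disjoint B B' →
      |∫ x, {z : V3 | ∃ c, z c < D ∨ L - D < z c}.indicator (fun _ => (1 : ℝ)) (x i) *
          (ψ (x i - x j) - ψ (g (x i - x j))) *
            (uR (fun y y' : V3 => ‖y - y'‖ < σ) x B * uR (fun y y' : V3 => ‖y - y'‖ < σ) x B')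
          ∂(Measure.pi fun _ : Fin n => ProbabilityTheory.cond volume {y : V3 | ∀ k, y k ∈ Set.Icc (0 : ℝ) L})| ≤
        (6 * D / L) * ((L ^ 3)⁻¹ * (2 * ∫ q, |ψ q|)) *
          ((treeNumber B.card * ((L ^ 3)⁻¹ * (σ ^ 3 * (Real.pi * 4 / 3))) ^ (B.card - 1)) *
            (treeNumber B'.card * ((L ^ 3)⁻¹ * (σ ^ 3 * (Real.pi * 4 / 3))) ^ (B'.card - 1)))) :=
  fun _ _ hσ hL _ _ hψm hψi g _ hD =>
    ⟨fun _ _ _ hi hj hij => abs_layerBracket_le hσ hL hψm hψi g hD hi hj hij,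
      fun _ _ _ _ hi hj hBB' => abs_layerBracket₂_le hσ hL hψm hψi g hD hi hj hBB'⟩

end Summit.AtomisticToContinuum.HydrodynamicLimit.Theorems.EnskogCompensator

end
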